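import Summits.CriticalPhenomena.CardyFormulaZ2.Theses.CardyBoundaryCoulombGas

/-!
# Line `scaling-tba-positive-logs` — skeleton for crux `StripClusterRates` (stmt-CriticalPhenomena-13878)

Route `route-CriticalPhenomena-CardyBoundaryCoulombGas`, sub-problem `CardyFormulaZ2`; crux decl
`Summit.CriticalPhenomena.CardyFormulaZ2.Theses.CardyBoundaryCoulombGas.StripClusterRates`
(Kac rates of the free axis-parallel strip: `n·γ₁(n) → π/3`, `n·γ₂(n) → 2π`), concluded BY NAME by
`StripClusterRates_of` / `stripClusterRates_proof` below. Planner `crux-plan`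
(planner-cruxplan-stmt-CriticalPhenomena-13878-scaling-tba-positive-0, 2026-08-16), idea card
`Cruxes/StripClusterRates/Ideas/scaling-tba-positive-logs.md` (ideator 1, round 1; triage r1: 3 × pass with the
mandatory repair "do not leave `u₂ y` unconstrained" — honoured here by writing the unknown `𝖺²` itself in the
product form `tanh((x-y)/2)·exp(K∗log(1+𝖺¹))`, which pins `𝖺²(y) = 0`), line card `Lines/scaling-tba-positive-logs.md`.

## The line (N → ∞ half of Bethe-free rigour for MDKP's `D₃`-TBA, arXiv:1701.08167 §3.6)

At `β = 1` the surface free energy is `1` and the bulk factor IS the Razumov–Stroganov eigenvalue, so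
`K(u) = -D_f(u+λ)` exactly and MDKP's auxiliary function `𝔞²(x) = K(ix/3 - π/6)` is MINUS the normalised sector
eigenvalue `𝔟(x) = Λ_d/Λ_RS (π/6 + ix/3)`; in particular the diagonal-strip Kac rate per double row is
`E_N = -log(-𝔞²_N(0)) = -2 Σ_j log tanh(x^j/2) - ∫ K log(1+𝔞¹_N)` (`efin`).  With the positivity lever of the card
(`𝔄² = |𝔞¹(·+iπ/2)|²`, `𝔄¹ = |𝔞²(·+iπ/2)|²`: every convolved logarithm is the real log of a positive function) the
finite-`N` TBA of MDKP eq. (TBAs) for the ground states `d = 2` (`t¹ = 0, t² = 1`) and `d = 4` (`t¹ = 0, t² = 2`,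
subcase B; `ϕ = ϕ¹ = 0`, `ϕ² = -iπ` in both cases) is the REAL system (`FinTBATwo` / `FinTBAFour`)
  T1 `𝔞¹(x) = tanh^{2N+2}(x/2) · exp(2 K∗log(1+𝔞²))`,
  T2 `𝔞²(x) = ± Π_j tanh((x-x^j)/2) tanh((x+x^j)/2) · exp(K∗log(1+𝔞¹))` (`+` for d = 2, `-` for d = 4),
  T3 `Q_N(x^j) := (2N+2)·arctan(1/sinh x^j) + π⁻¹ ∫ log(1+𝔞²(t))/sinh(t-x^j) dt = (2k^j-1)π` (k¹ = 1; k = (1,2)),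
`K(x) = 1/(2π cosh x)` (`tbaK`, mass 1/2).  NUMERICAL CHECK run this session (folder `compute/tba_finite.py`, pure
python, spectrally converged, h = 0.05 and 0.025 agree to 12 digits): the d = 2 system T1–T3 reproduces the EXACT
diagonal-strip Perron data `-N·log(Λ₂/Λ_RS)(π/6) = 1.845971, 1.922765, 1.963720, 1.989072` (N = 4, 6, 8, 10; triage
E3 / card diagonal-strip-dkkmo-transfer, two independent TL codes) as `N·E_N = 1.845971486, 1.922764702,
1.963720004, 1.989071880`, and continues `2.00627, 2.04127, 2.07319, 2.08383, 2.08913, 2.09335` (N = 12, 20, 50, 100,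
200, 1000) → `2π/3 = 2.094395`, with scaled zero `x¹_N - log N = 0.7045, 0.6603, …, 0.57195` (N = 1000) → MDKP's
scaling zero `y = 0.571435` (triage): the finite-`N` interface `stub_latticeTBA` (d = 2 clause) and the conclusion of
`stub_scalingLimitTwo` are thereby checked numerically; for d = 4 the joint Newton solver `compute/tba_d4_newton.py`
(zeros and subcase-B tail solved together) gives `N·E_N = 11.920912, 11.837073, 11.921138, 12.006878` (N = 4, 6, 8, 10)
against the exact `11.9209, 11.8371, 11.9211, 12.0069`, then `12.2509, 12.4361, 12.5342` (N = 20, 50, 200) ↑ `4π`, scaled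
zeros `(0.331, -0.717) → (≈0.14, ≈-0.83)` bounded: the d = 4 clause and MDKP's integers `k = (1,2)` (outer zero ↦ π,
inner ↦ 3π; the swap has no solution) are checked the same way.

Stubs (6, the only `sorry`s): `stub_orientationBridge` (diagonal Kac limits ⇒ axis Kac limits: DKKMO rotation
invariance at q = 1 + orientation-uniform Fekete sandwich — card diagonal-strip-dkkmo-transfer, shared),
`stub_latticeTBA` (finite-`N` TBA REPRESENTATION of the diagonal-strip rates with bounded scaled zeros — the
finite-`N` analyticity half: card vesica-zero-free-perron-branch + MDPR14 `Y`-system + Klümper–Pearce Fourier step +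
rate = sector Perron eigenvalue; shared), and this line's own analysis: `stub_dilogTwo`, `stub_dilogFour` (MDKP's
dilogarithm identity: the scaling read-out `R = 2Σe^{-y^j} - π⁻¹∫e^{-t}log(1+𝖺¹)` equals `π·Δ_{1,d+1}` = `π/3`,
`2π` for EVERY solution of the scaling system `ScalTBATwo` / `ScalTBAFour`), `stub_scalingLimitTwo`,
`stub_scalingLimitFour` (compactness + identification: along any sequence of finite-`N` TBA data with bounded scaled
zeros, `N·E_N → 2R`).  Well-posedness (`∃!`) of the scaling system — the card's original `C⁺` — is NOT load-bearing
for the crux (the dilogarithm identity holds for every solution, so subsequential limits need not be identified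
with each other); it is recorded in the line card as the natural tool for the limit stubs, not registered.
Composition: `StripClusterRates_of` (kernel-checked, no `sorry`) + the route's support item `StripRatesExist`
(stmt-CriticalPhenomena-13879, admissible hypothesis by name) for the existence conjuncts.

## Disproof used (`Cruxes/StripClusterRates/Disproof.lean`, cdisprove cycle 1, NO KILL)
No `_false_without_` theorem exists (§1: the crux's only hypothesis `1 ≤ n` is not load-bearing) and no Negative
lemma has landed — nothing to import or honour by a named stub.  §3 `not_kacLowerBoundEveryWidth₁/₂` (Kac values
are limits approached from below): honoured — every stub produces `π/3`, `2π` only as `N → ∞` limits; the finite-`N`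
read-out `N·E_N` computed here IS below `2π/3` and increasing (1.846 … 2.093).  §4 numerics (slopes → 3/π, 1/(2π))
are what `stub_orientationBridge` transports (factor 2 between diagonal `2π/3, 4π` and axis `π/3, 2π`).  §6 near-misses
(`rate₂_width_one`, `rate₁_width_one`) are width-1 facts orthogonal to this line.  Negatives index of the summit
(stmt-0748, -6949, -6952 …): no stub is an instance.
-/

noncomputable section

open Real MeasureTheory Filter Set
open scoped Topology
open Literature.Probability.Percolation Literature.Probability.LatticeModels
open Summit.CriticalPhenomena.CardyFormulaZ2.Theses.CardyBoundaryCoulombGas (StripClusterRates StripRatesExist)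

namespace Summit.CriticalPhenomena.CardyFormulaZ2.Cruxes.StripClusterRates.ScalingTbaPositiveLogs

/-! ### Percolation side: the crux's axis-strip rates and the 45°-diagonal strip -/

/-- Verbatim copy of the crux's second event: two open left–right crossings of `[0,m]×[0,n]` in distinct open
clusters of the rectangle. -/
def twoClusterEvent (m n : ℕ) : Set (BondConfig (Site 2)) :=
  {ω | ∃ x₁ ∈ (leftSide m n : Set (Site 2)), ∃ y₁ ∈ (rightSide m n : Set (Site 2)),
    ∃ x₂ ∈ (leftSide m n : Set (Site 2)), ∃ y₂ ∈ (rightSide m n : Set (Site 2)),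
      ω ∈ openConnIn (rectangle m n : Set (Site 2)) x₁ y₁ ∧
      ω ∈ openConnIn (rectangle m n : Set (Site 2)) x₂ y₂ ∧
      ω ∉ openConnIn (rectangle m n : Set (Site 2)) x₁ x₂}

/-- `γ` is the lengthwise one-cluster rate of the axis strip of width `n` (first `Tendsto` of the crux). -/
def AxisRateOne (n : ℕ) (γ : ℝ) : Prop :=
  Tendsto (fun m : ℕ ↦ -Real.log (crossingProb half m n) / (m : ℝ)) atTop (𝓝 γ)

/-- `γ` is the lengthwise two-cluster rate of the axis strip of width `n` (second `Tendsto` of the crux). -/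
def AxisRateTwo (n : ℕ) (γ : ℝ) : Prop :=
  Tendsto (fun m : ℕ ↦ -Real.log ((bondPercolation (zdGraph 2) half).real (twoClusterEvent m n)) / (m : ℝ))
    atTop (𝓝 γ)

/-- The free 45°-diagonal strip of `ℤ²` of width `w` (= `w` Temperley–Lieb strands = `w` bonds per diagonal
layer) and length `L` double layers: sites with `0 ≤ v₀ - v₁ ≤ w` and `0 ≤ v₀ + v₁ ≤ 2L`.  Bond percolation on it,
read layer by layer in `s = v₀ + v₁`, is MDKP's double-row tangle `D(π/6)` (two layers per step) up to the
Razumov–Stroganov scalar (card diagonal-strip-dkkmo-transfer; triage F2/E3). -/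
def diagStrip (w L : ℕ) : Set (Site 2) :=
  {v | 0 ≤ v 0 - v 1 ∧ v 0 - v 1 ≤ w ∧ 0 ≤ v 0 + v 1 ∧ v 0 + v 1 ≤ 2 * L}

/-- Bottom diagonal `v₀ + v₁ = 0` of the diagonal strip. -/
def diagBottom (w : ℕ) : Set (Site 2) := {v | 0 ≤ v 0 - v 1 ∧ v 0 - v 1 ≤ w ∧ v 0 + v 1 = 0}

/-- Top diagonal `v₀ + v₁ = 2L` of the diagonal strip. -/
def diagTop (w L : ℕ) : Set (Site 2) := {v | 0 ≤ v 0 - v 1 ∧ v 0 - v 1 ≤ w ∧ v 0 + v 1 = 2 * L}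

/-- "≥ 1 spanning cluster": an open path inside the diagonal strip from its bottom to its top diagonal. -/
def diagOne (w L : ℕ) : Set (BondConfig (Site 2)) := openCrossing (diagStrip w L) (diagBottom w) (diagTop w L)

/-- "≥ 2 distinct spanning clusters" of the diagonal strip (the crux's second event, rotated). -/
def diagTwo (w L : ℕ) : Set (BondConfig (Site 2)) :=
  {ω | ∃ x₁ ∈ diagBottom w, ∃ y₁ ∈ diagTop w L, ∃ x₂ ∈ diagBottom w, ∃ y₂ ∈ diagTop w L,
    ω ∈ openConnIn (diagStrip w L) x₁ y₁ ∧ ω ∈ openConnIn (diagStrip w L) x₂ y₂ ∧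
    ω ∉ openConnIn (diagStrip w L) x₁ x₂}

/-- `ρ` is the lengthwise (per double layer) decay rate of the events `E w ·` at p = 1/2. -/
def IsDiagRate (E : ℕ → ℕ → Set (BondConfig (Site 2))) (w : ℕ) (ρ : ℝ) : Prop :=
  Tendsto (fun L : ℕ ↦ -Real.log ((bondPercolation (zdGraph 2) half).real (E w L)) / (L : ℝ)) atTop (𝓝 ρ)

/-- **Diagonal Kac rates** (the transfer target every integrability line feeds): along even widths `N = 2j` the two
diagonal-strip rates exist and `N·ρ₁(N) → 2π/3 = 2π·Δ_{1,3}`, `N·ρ₂(N) → 4π = 2π·Δ_{1,5}` (numerically: `N·ρ₁ =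
1.8460, 1.9228, 1.9637, 1.9891` for N = 4..10, slope of `1/ρ₁` → 3/(2π); `N·ρ₂ = 11.92, 11.84, 11.92, 12.01`). -/
def DiagonalKacRates : Prop :=
  ∃ ρ₁ ρ₂ : ℕ → ℝ,
    (∀ j : ℕ, 1 ≤ j → IsDiagRate diagOne (2 * j) (ρ₁ j)) ∧
    (∀ j : ℕ, 1 ≤ j → IsDiagRate diagTwo (2 * j) (ρ₂ j)) ∧
    Tendsto (fun j : ℕ ↦ ((2 * j : ℕ) : ℝ) * ρ₁ j) atTop (𝓝 (2 * π / 3)) ∧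
    Tendsto (fun j : ℕ ↦ ((2 * j : ℕ) : ℝ) * ρ₂ j) atTop (𝓝 (4 * π))

/-! ### Analysis side: MDKP's TBA in real form -/

/-- MDKP's TBA kernel `K(x) = 1/(2π cosh x)` (eq. (K); total mass `1/2`). -/
def tbaK (x : ℝ) : ℝ := 1 / (2 * π * Real.cosh x)

/-- Convolution `(K ∗ f)(x) = ∫ K(x - t) f(t) dt` (Bochner; genuine for the integrands below). -/
def kconv (f : ℝ → ℝ) (x : ℝ) : ℝ := ∫ t, tbaK (x - t) * f t

/-- The quantisation integral `∫ log(1 + a₂(t)) / sinh(t - z) dt` (absolutely convergent at a zero `z` of `a₂`: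
the numerator vanishes linearly there). -/
def qInt (a₂ : ℝ → ℝ) (z : ℝ) : ℝ := ∫ t, Real.log (1 + a₂ t) / Real.sinh (t - z)

/-- Finite-`N` quantisation functional `Q_N(z) = (2N+2)·arctan(1/sinh z) + π⁻¹ ∫ log(1+a₂)/sinh(· - z)`
(imaginary part of MDKP's `ln 𝔞¹(z - iπ/2) = ln(-1)`; `(2N+2)·arctan(1/sinh(log N + y)) → 4e^{-y}`). -/
def quantFin (N : ℕ) (a₂ : ℝ → ℝ) (z : ℝ) : ℝ :=
  (2 * N + 2) * Real.arctan (Real.sinh z)⁻¹ + π⁻¹ * qInt a₂ z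

/-- Scaling quantisation functional `Q_∞(y) = 4e^{-y} + π⁻¹ ∫ log(1+𝖺²)/sinh(· - y)` (MDKP eq. (integerK) with
`t¹ = 0`, `ϕ¹ = 0`). -/
def quantInf (a₂ : ℝ → ℝ) (y : ℝ) : ℝ := 4 * Real.exp (-y) + π⁻¹ * qInt a₂ y

/-- Finite-`N` read-out `E_N = -2 Σ_j log tanh(x^j/2) - ∫ K(t) log(1 + 𝔞¹(t)) dt = -log(-𝔞²(0))`: minus the log
of the normalised sector eigenvalue `Λ_d(π/6)/Λ_RS(π/6)`, i.e. the diagonal-strip rate per double layer. -/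
def efin (a₁ : ℝ → ℝ) (zs : List ℝ) : ℝ :=
  -2 * (zs.map fun z ↦ Real.log (Real.tanh (z / 2))).sum - ∫ t, tbaK t * Real.log (1 + a₁ t)

/-- Scaling read-out `R = 2 Σ_j e^{-y^j} - π⁻¹ ∫ e^{-t} log(1 + 𝖺¹(t)) dt` (MDKP eq. (FSC1): `N·E_N → 2R`). -/
def rout (a₁ : ℝ → ℝ) (ys : List ℝ) : ℝ :=
  2 * (ys.map fun y ↦ Real.exp (-y)).sum - π⁻¹ * ∫ t, Real.exp (-t) * Real.log (1 + a₁ t)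

/-- **Finite-`N` TBA data, `d = 2` ground state** (`t¹ = 0`, `t² = 1`, `k¹ = 1`; braid values `𝔞¹ → 3`, `𝔞² → 2`):
the real system T1–T3 for the pair `(𝔞¹, 𝔞²)` restricted to the real axis and the positive real zero `x₁` of `𝔞²`,
with the qualitative lattice facts (continuity, evenness, the a-priori bounds `0 ≤ 𝔞¹ ≤ 3`, `-1 < 𝔞² ≤ 2` — the
lower bound `-1 < 𝔞²` is the positivity input `𝔄² ≠ 0` on `ℝ`, the upper bounds follow from T1–T2 and `∫K = 1/2`)
and the integrability of the two non-trivially convergent integrands (kills Lean-junk solutions). -/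
structure FinTBATwo (N : ℕ) (a₁ a₂ : ℝ → ℝ) (x₁ : ℝ) : Prop where
  cont₁ : Continuous a₁
  cont₂ : Continuous a₂
  even₁ : ∀ x, a₁ (-x) = a₁ x
  even₂ : ∀ x, a₂ (-x) = a₂ x
  bound₁ : ∀ x, 0 ≤ a₁ x ∧ a₁ x ≤ 3
  bound₂ : ∀ x, -1 < a₂ x ∧ a₂ x ≤ 2
  zero_pos : 0 < x₁
  integrable₂ : ∀ x, Integrable fun t ↦ tbaK (x - t) * Real.log (1 + a₂ t)
  integrableQ : Integrable fun t ↦ Real.log (1 + a₂ t) / Real.sinh (t - x₁)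
  eq₁ : ∀ x, a₁ x = Real.tanh (x / 2) ^ (2 * N + 2) * Real.exp (2 * kconv (fun t ↦ Real.log (1 + a₂ t)) x)
  eq₂ : ∀ x, a₂ x = Real.tanh ((x - x₁) / 2) * Real.tanh ((x + x₁) / 2) *
    Real.exp (kconv (fun t ↦ Real.log (1 + a₁ t)) x)
  quant : quantFin N a₂ x₁ = π

/-- **Finite-`N` TBA data, `d = 4` ground state** (`t¹ = 0`, `t² = 2`, subcase B: braid values `𝔞¹ → 0⁺`,
`𝔞² → -1⁺`; sign `-` in T2 from `ϕ² = -iπ(t²-1)`; zeros `0 < x₂ < x₁`; integers `k = (1,2)` (MDKP §3.7, `k^j = j`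
for `d ≡ 1 mod 3`): `Q_N(x₁) = π` at the OUTER zero, `Q_N(x₂) = 3π` at the inner one — VERIFIED this session by the joint
Newton solver `compute/tba_d4_newton.py`: `N·E_N = 11.920912, 11.837073, 11.921138, 12.006878` (N = 4, 6, 8, 10) against
the exact transfer-matrix values `11.9209, 11.8371, 11.9211, 12.0069` (triage E3), then `12.2509, 12.4361, 12.5342`
(N = 20, 50, 200) ↑ `4π = 12.5664`; the swapped assignment `(3π, π)` has no solution (Newton stalls at ‖R‖ ≈ 6);
the two subcase-B tail amplitudes agree (`κ₁ ≈ κ₂`, e.g. 80.7/80.9 at N = 4) as the `Y`-system predicts). -/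
structure FinTBAFour (N : ℕ) (a₁ a₂ : ℝ → ℝ) (x₁ x₂ : ℝ) : Prop where
  cont₁ : Continuous a₁
  cont₂ : Continuous a₂
  even₁ : ∀ x, a₁ (-x) = a₁ x
  even₂ : ∀ x, a₂ (-x) = a₂ x
  bound₁ : ∀ x, 0 ≤ a₁ x ∧ a₁ x ≤ 3
  bound₂ : ∀ x, -1 < a₂ x ∧ a₂ x ≤ 2
  zeros : 0 < x₂ ∧ x₂ < x₁
  integrable₂ : ∀ x, Integrable fun t ↦ tbaK (x - t) * Real.log (1 + a₂ t)
  integrableQ₁ : Integrable fun t ↦ Real.log (1 + a₂ t) / Real.sinh (t - x₁)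
  integrableQ₂ : Integrable fun t ↦ Real.log (1 + a₂ t) / Real.sinh (t - x₂)
  eq₁ : ∀ x, a₁ x = Real.tanh (x / 2) ^ (2 * N + 2) * Real.exp (2 * kconv (fun t ↦ Real.log (1 + a₂ t)) x)
  eq₂ : ∀ x, a₂ x = -(Real.tanh ((x - x₁) / 2) * Real.tanh ((x + x₁) / 2) *
    (Real.tanh ((x - x₂) / 2) * Real.tanh ((x + x₂) / 2))) * Real.exp (kconv (fun t ↦ Real.log (1 + a₁ t)) x)
  quant₁ : quantFin N a₂ x₁ = π
  quant₂ : quantFin N a₂ x₂ = 3 * π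

/-- **Scaling TBA, `d = 2`** (MDKP eq. (scalNLIE) at `t¹ = 0, t² = 1, k¹ = 1`, real form; the triage-verified
system: unique numerical fixed point `y = 0.5714349565`, `𝖺¹(∞) = 3`, `𝖺²(∞) = 2`, read-out `R/π = 0.3333334`).
Unknowns: `𝖺¹ ≥ 0` bounded, `𝖺²` with its single real zero `y` built into the product form.  Positivity of `1 + 𝖺²` is
NON-STRICT here (closed under the limits `stub_scalingLimitTwo` takes; touch points, if any, are null sets the
integrability fields keep harmless), STRICT in the finite-`N` data. -/
structure ScalTBATwo (a₁ a₂ : ℝ → ℝ) (y : ℝ) : Prop where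
  cont₁ : Continuous a₁
  cont₂ : Continuous a₂
  bound₁ : ∀ x, 0 ≤ a₁ x ∧ a₁ x ≤ 3
  bound₂ : ∀ x, -1 ≤ a₂ x ∧ a₂ x ≤ 2
  integrable₂ : ∀ x, Integrable fun t ↦ tbaK (x - t) * Real.log (1 + a₂ t)
  integrableQ : Integrable fun t ↦ Real.log (1 + a₂ t) / Real.sinh (t - y)
  integrableR : Integrable fun t ↦ Real.exp (-t) * Real.log (1 + a₁ t)
  eq₁ : ∀ x, a₁ x = Real.exp (-4 * Real.exp (-x)) * Real.exp (2 * kconv (fun t ↦ Real.log (1 + a₂ t)) x)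
  eq₂ : ∀ x, a₂ x = Real.tanh ((x - y) / 2) * Real.exp (kconv (fun t ↦ Real.log (1 + a₁ t)) x)
  quant : quantInf a₂ y = π

/-- **Scaling TBA, `d = 4`** (subcase B ground state: `t¹ = 0, t² = 2`, sign `-`, zeros `y₂ < y₁` with
`Q_∞(y₁) = π`, `Q_∞(y₂) = 3π`; `𝖺¹ → 0`, `𝖺² → -1` at `+∞` are consequences, not imposed; `1 + 𝖺² ≥ 0` non-strict as
in `ScalTBATwo`; numerically `y₁ ≈ 0.14`, `y₂ ≈ -0.83`, `κ' ≈ 9` from the finite-`N` runs). -/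
structure ScalTBAFour (a₁ a₂ : ℝ → ℝ) (y₁ y₂ : ℝ) : Prop where
  cont₁ : Continuous a₁
  cont₂ : Continuous a₂
  bound₁ : ∀ x, 0 ≤ a₁ x ∧ a₁ x ≤ 3
  bound₂ : ∀ x, -1 ≤ a₂ x ∧ a₂ x ≤ 2
  zeros : y₂ < y₁
  integrable₂ : ∀ x, Integrable fun t ↦ tbaK (x - t) * Real.log (1 + a₂ t)
  integrableQ₁ : Integrable fun t ↦ Real.log (1 + a₂ t) / Real.sinh (t - y₁)
  integrableQ₂ : Integrable fun t ↦ Real.log (1 + a₂ t) / Real.sinh (t - y₂)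
  integrableR : Integrable fun t ↦ Real.exp (-t) * Real.log (1 + a₁ t)
  eq₁ : ∀ x, a₁ x = Real.exp (-4 * Real.exp (-x)) * Real.exp (2 * kconv (fun t ↦ Real.log (1 + a₂ t)) x)
  eq₂ : ∀ x, a₂ x = -(Real.tanh ((x - y₁) / 2) * Real.tanh ((x - y₂) / 2)) *
    Real.exp (kconv (fun t ↦ Real.log (1 + a₁ t)) x)
  quant₁ : quantInf a₂ y₁ = π
  quant₂ : quantInf a₂ y₂ = 3 * π

/-! ### The six statements of the line -/

/-- Statement of `stub_orientationBridge`. -/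
def OrientationBridge : Prop :=
  DiagonalKacRates → ∀ γ₁ γ₂ : ℕ → ℝ,
    (∀ n : ℕ, 1 ≤ n → AxisRateOne n (γ₁ n)) → (∀ n : ℕ, 1 ≤ n → AxisRateTwo n (γ₂ n)) →
      Tendsto (fun n : ℕ ↦ (n : ℝ) * γ₁ n) atTop (𝓝 (π / 3)) ∧
      Tendsto (fun n : ℕ ↦ (n : ℝ) * γ₂ n) atTop (𝓝 (2 * π))

/-- Statement of `stub_latticeTBA`. -/
def LatticeTBA : Prop :=
  ∃ ρ₁ ρ₂ : ℕ → ℝ,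
    (∀ j : ℕ, 1 ≤ j → IsDiagRate diagOne (2 * j) (ρ₁ j)) ∧
    (∀ j : ℕ, 1 ≤ j → IsDiagRate diagTwo (2 * j) (ρ₂ j)) ∧
    (∃ (C : ℝ) (a₁ a₂ : ℕ → ℝ → ℝ) (x₁ : ℕ → ℝ), ∀ᶠ j : ℕ in atTop,
      FinTBATwo (2 * j) (a₁ j) (a₂ j) (x₁ j) ∧ |x₁ j - Real.log ((2 * j : ℕ) : ℝ)| ≤ C ∧
        ρ₁ j = efin (a₁ j) [x₁ j]) ∧
    (∃ (C : ℝ) (a₁ a₂ : ℕ → ℝ → ℝ) (x₁ x₂ : ℕ → ℝ), ∀ᶠ j : ℕ in atTop,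
      FinTBAFour (2 * j) (a₁ j) (a₂ j) (x₁ j) (x₂ j) ∧ |x₁ j - Real.log ((2 * j : ℕ) : ℝ)| ≤ C ∧
        |x₂ j - Real.log ((2 * j : ℕ) : ℝ)| ≤ C ∧ ρ₂ j = efin (a₁ j) [x₁ j, x₂ j])

/-- Statement of `stub_dilogTwo`. -/
def DilogTwo : Prop := ∀ (a₁ a₂ : ℝ → ℝ) (y : ℝ), ScalTBATwo a₁ a₂ y → rout a₁ [y] = π / 3

/-- Statement of `stub_dilogFour`. -/
def DilogFour : Prop := ∀ (a₁ a₂ : ℝ → ℝ) (y₁ y₂ : ℝ), ScalTBAFour a₁ a₂ y₁ y₂ → rout a₁ [y₁, y₂] = 2 * π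

/-- Statement of `stub_scalingLimitTwo`. -/
def ScalingLimitTwo : Prop :=
  ∀ R : ℝ, (∀ (a₁ a₂ : ℝ → ℝ) (y : ℝ), ScalTBATwo a₁ a₂ y → rout a₁ [y] = R) →
    ∀ (Ns : ℕ → ℕ) (a₁ a₂ : ℕ → ℝ → ℝ) (x₁ : ℕ → ℝ) (C : ℝ), Tendsto Ns atTop atTop →
      (∀ᶠ i : ℕ in atTop, FinTBATwo (Ns i) (a₁ i) (a₂ i) (x₁ i) ∧ |x₁ i - Real.log (Ns i)| ≤ C) →
        Tendsto (fun i : ℕ ↦ (Ns i : ℝ) * efin (a₁ i) [x₁ i]) atTop (𝓝 (2 * R))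

/-- Statement of `stub_scalingLimitFour`. -/
def ScalingLimitFour : Prop :=
  ∀ R : ℝ, (∀ (a₁ a₂ : ℝ → ℝ) (y₁ y₂ : ℝ), ScalTBAFour a₁ a₂ y₁ y₂ → rout a₁ [y₁, y₂] = R) →
    ∀ (Ns : ℕ → ℕ) (a₁ a₂ : ℕ → ℝ → ℝ) (x₁ x₂ : ℕ → ℝ) (C : ℝ), Tendsto Ns atTop atTop →
      (∀ᶠ i : ℕ in atTop, FinTBAFour (Ns i) (a₁ i) (a₂ i) (x₁ i) (x₂ i) ∧
        |x₁ i - Real.log (Ns i)| ≤ C ∧ |x₂ i - Real.log (Ns i)| ≤ C) →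
        Tendsto (fun i : ℕ ↦ (Ns i : ℝ) * efin (a₁ i) [x₁ i, x₂ i]) atTop (𝓝 (2 * R))

/-! ### Registered stubs (the only `sorry`s of the file) -/

/-- **stub_orientationBridge** [L; card diagonal-strip-dkkmo-transfer, triage 3 × pass]: the axis-parallel Kac
rates of the crux inherit the limits of the diagonal ones with the geometric factor 1/2 (`π/3 = ½·2π/3`,
`2π = ½·4π`).  Mechanism: `n·γ_k(n) = -log P[k clusters cross Kn × n]/K + O(1/K)` uniformly in `n` (sub- and super-
multiplicativity, Harris–FKG gluing through a top–bottom crossing of the overlap square with `P ≥ 1/2` by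
`crossingProb_half_succ_self_holds`, `crossingProb_long_le` for the `n`-uniform RSW cost; for `k = 2` an
arm-separation input), the same sandwich on the diagonal strip (monotone in the width, so even widths suffice), and
`dkkmo_crossing_rotation_invariance` (DKKMO 2020 Cor. 1.3 at q = 1, tree, per quad, α = π/4; loop form
`dkkmo_rotation_invariance` + continuity of the two-cluster event for `k = 2`) comparing the long rectangle with
its 45° rotation at fixed aspect ratio.  Why it might fail: only through the `k = 2` continuity/separation inputs;
the `k = 1` half is DKKMO + RSW bookkeeping. -/
theorem stub_orientationBridge : OrientationBridge := by
  sorry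

/-- **stub_latticeTBA** [XL — the finite-`N` ANALYTICITY half, shared with line vesica-zero-free-perron-branch; its
d = 2 clause is checked numerically at N = 4..12 to 7 digits against exact transfer-matrix data, see the module
docstring]: along even widths `N = 2j` the diagonal-strip rates `ρ₁, ρ₂` exist (Fekete) and, for all large `j`,
are REPRESENTED by finite-`N` TBA data: `ρ₁(j) = efin a₁ [x₁]` for some solution of `FinTBATwo (2j)` and
`ρ₂(j) = efin a₁ [x₁, x₂]` for some solution of `FinTBAFour (2j)`, with the scaled zeros `x - log N` bounded.
Content: (i) rate = `-log` of the sector Perron eigenvalue `Λ_{2k}(π/6)/Λ_RS(π/6)` of MDKP's `D(u)` on the standard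
module `W_{2k}` of `TL_N(1)` (block-triangularity in the number of spanning clusters, positive boundary overlap;
for `k = 2` the Loewy identity `rad W₀ ≅ L₄`, cards two-cluster-rate-is-stationary-gap / stochastic-sector-mixing-
rate); (ii) MDPR14's fusion hierarchy / closed `D₃` `Y`-system (a theorem, diagrammatic); (iii) the analyticity
input — zero-freeness of `Λ_{2k}` in the closed physical strip `0 ≤ Re u ≤ π/3` except `t² = k` central pairs, of
`1 + K` in `-π/3 < Re u < 0`, of the fused branch in `|Re u| ≤ π/6` and of `1 + d¹` in `|Re u| < π/6` (card
vesica-zero-free-perron-branch's `C⁺` with the triage-3 fused additions; confirmed N ≤ 12); (iv) the Klümper–Pearce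
Fourier step turning (ii)+(iii) into T1–T3 (the positivity lever makes every log real); (v) `β = 1`: `D_s = 1`,
`D_b = Λ_RS`, hence `𝔞² = -𝔟` and `efin = -log(-𝔞²(0))`; (vi) boundedness of `x^j_N - log N` (numerically
d = 2: 0.70 ↓ 0.57; d = 4: (0.33, -0.72) → (0.14, -0.83), monotone).  Both clauses are checked against exact
transfer-matrix data at N = 4..10 (module docstring).  Why it might fail: (iii) is MDKP's empirical input — open;
(vi) is of the same type. -/
theorem stub_latticeTBA : LatticeTBA := by
  sorry

/-- **stub_dilogTwo** [M; MDKP §3.6 "dilogarithm technique" + App. A Rogers identities, made rigorous for the real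
system]: for EVERY solution of `ScalTBATwo`, `R = 2e^{-y} - π⁻¹∫e^{-t}log(1+𝖺¹) = π·Δ_{1,3} = π/3`.  Route: the
integral `𝒥 = Σ_n ∫ ((ln 𝖺ⁿ)' ln 𝖠ⁿ - ln|𝖺ⁿ| (ln 𝖠ⁿ)')` evaluated (a) through the equations and the symmetry of
`K` as `8∫e^{-t}ln 𝖠¹ + 2∫ln 𝖠²/sinh(· - y)` (surface terms vanish: constant asymptotics `3, 2` at `+∞`,
super-exponential decay of `𝖺¹` and `1 + 𝖺² ≍ e^{x}` at `-∞`), (b) by the substitution `t ↦ 𝖺` as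
`2L₊(3) + 4L₊(2) + 4L(1) = 4π²/3` (Rogers `L`); combined with the quantisation `Q_∞(y) = π` this is `R = π/3`
(numerically 0.3333334·π, triage).  Why it might fail: only bookkeeping of branches, which the real form has
already absorbed (`k¹ = 1` ↔ `Q_∞ = π`, `θ²` ↔ the sign change of `𝖺²` at `y`). -/
theorem stub_dilogTwo : DilogTwo := by
  sorry

/-- **stub_dilogFour** [M–L; same technique, subcase-B asymptotics]: for every solution of `ScalTBAFour`,
`R = 2(e^{-y₁} + e^{-y₂}) - π⁻¹∫e^{-t}log(1+𝖺¹) = π·Δ_{1,5} = 2π` (MDKP: `Δ = Σk^j + τ = 1 + 2 - ½t² = 2`,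
`𝒥 = 𝒦_{-1}(2π/3) = 0` since `𝖺¹(∞) = 0`, `𝖺²(∞) = -1`).  Extra care: at `+∞`, `log(1 + 𝖺²) → -∞` linearly
(rate 4/3 forced by `2cos(2π/3) = -1`, any other rate contradicts `1 + 𝖺² > 0` through the resonance of `K` at
rate 1), so the surface terms of the integrations by parts need the decay of `(ln 𝖠¹)'`.  (Only `Σ(2k^j - 1) = 4` enters the value.) -/
theorem stub_dilogFour : DilogFour := by
  sorry

/-- **stub_scalingLimitTwo** [M–L; this line's load-bearing analysis, replacing MDKP's "we assume that the
scaling limits exist"]: if every scaling solution has read-out `R`, then along ANY sequence `N_i → ∞` of finite-`N`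
TBA data with bounded scaled zero, `N_i · efin → 2R`.  Route: scaled functions `𝔞ⁿ_i(· + log N_i)` obey the scaled
system with driving term `(2N+2) log tanh((x + log N)/2) → -4e^{-x}` and a far end at `-2 log N` whose influence is
`O(N^{-2})`; a-priori bounds are built into the data, equicontinuity comes from the convolution structure
(`K' ∈ L¹`), quantitative positivity of `1 + 𝔞²` on compacts of the scaled window follows from T1 (`K > 0`
everywhere: if `log(1+𝔞²_i) → -∞` on a set of positive measure then `𝔞¹_i → 0` everywhere, `𝔞²_i → tanh`,
contradiction); Arzelà–Ascoli + dominated convergence identify every subsequential limit as a `ScalTBATwo`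
solution `(𝖺¹, 𝖺², y)`, and `N·(-2 log tanh(x₁/2)) → 4e^{-y}`, `N·∫K log(1+𝔞¹_N) → (2/π)∫e^{-t}log(1+𝖺¹)`
(since `N·K(t + log N) ↑ e^{-t}/π`, dominated by the super-exponential smallness of `𝔞¹` in the bulk) give
`N_i·efin → 2·rout = 2R` along the subsequence; sub-subsequence argument.  Uniqueness of the scaling solution is NOT
needed (convenient if available: then the scaled data themselves converge).  Why it might fail: a loss of
positivity / mass escaping to the far end that the a-priori structure does not exclude — none seen numerically
(N·E_N = 1.846 … 2.0933 ↑ 2π/3, `x₁ - log N` = 0.70 ↓ 0.5719, `min(1+𝔞²) = 1+𝔞²(0) ≈ πΔ/N`). -/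
theorem stub_scalingLimitTwo : ScalingLimitTwo := by
  sorry

/-- **stub_scalingLimitFour** [L; as `stub_scalingLimitTwo` for the `d = 4` data, plus the subcase-B tail]: the
additional point is the behaviour at `+∞` of the scaled window, where `1 + 𝔞² → 0⁺` (braid value `-1`): limits of
the data keep `1 + 𝖺² > 0` pointwise (strictness from T2: `𝖺² = -1` at a finite point would force
`K∗log(1+𝖺¹) = -log|tanh·tanh| > 0`-compatible values — to be checked in the proof) and the quantisation integrals
converge uniformly thanks to the `1/sinh` weight; the integer data `(π, 3π)` pass to the limit by continuity of
`Q` along the data (`(2N+2)·arctan(1/sinh(log N + y)) → 4e^{-y}` locally uniformly).  Why it might fail: loss of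
strict ordering `y₂ < y₁` in the limit (zeros merging) — excluded numerically (`y₁ - y₂ → 0.97`), to be derived from
`Q_∞(y₁) ≠ Q_∞(y₂)`. -/
theorem stub_scalingLimitFour : ScalingLimitFour := by
  sorry

/-! ### Name-keyed aliases of the six statements (hypotheses of the composition)

`__Registered.stub_X` is the statement of `stub_X` under the registered stub's short name, so that the native
skeleton audit (`#h21_check_skeleton`: hypotheses admissible iff registered obligations / declared stubs BY NAME)
accepts `StripClusterRates_of : __Registered.stub_… → … → StripRatesExist → StripClusterRates` (device of
`Cruxes/LoopsToCrossings/Lines/br-sandwich-diagonal.lean`). -/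
namespace __Registered

/-- Alias of `OrientationBridge` keyed by the registered stub name. -/
abbrev stub_orientationBridge : Prop := OrientationBridge
/-- Alias of `LatticeTBA` keyed by the registered stub name. -/
abbrev stub_latticeTBA : Prop := LatticeTBA
/-- Alias of `DilogTwo` keyed by the registered stub name. -/
abbrev stub_dilogTwo : Prop := DilogTwo
/-- Alias of `DilogFour` keyed by the registered stub name. -/
abbrev stub_dilogFour : Prop := DilogFour
/-- Alias of `ScalingLimitTwo` keyed by the registered stub name. -/
abbrev stub_scalingLimitTwo : Prop := ScalingLimitTwo
/-- Alias of `ScalingLimitFour` keyed by the registered stub name. -/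
abbrev stub_scalingLimitFour : Prop := ScalingLimitFour

end __Registered

/-! ### The composition (kernel-checked, no `sorry`) -/

theorem tendsto_two_mul_atTop : Tendsto (fun j : ℕ ↦ 2 * j) atTop atTop :=
  tendsto_atTop_mono (fun j ↦ Nat.le_mul_of_pos_left j Nat.zero_lt_two) tendsto_id

/-- **`StripClusterRates` from the six stubs and the route's support item `StripRatesExist`.**  The axis rates
`γ₁ γ₂` exist by `StripRatesExist`; `stub_latticeTBA` represents the diagonal rates along even widths by finite-`N`
TBA data; `stub_scalingLimitTwo/Four` fed with `stub_dilogTwo/Four` give `N·ρ₁(N) → 2·(π/3)`, `N·ρ₂(N) → 2·(2π)`,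
i.e. `DiagonalKacRates`; `stub_orientationBridge` transports the two limits to the axis strip. -/
theorem StripClusterRates_of (hB : __Registered.stub_orientationBridge) (hL : __Registered.stub_latticeTBA)
    (hD₂ : __Registered.stub_dilogTwo) (hD₄ : __Registered.stub_dilogFour)
    (hS₂ : __Registered.stub_scalingLimitTwo) (hS₄ : __Registered.stub_scalingLimitFour)
    (hE : StripRatesExist) : StripClusterRates := by
  -- axis rates from the support item
  have hE₁ : ∀ n : ℕ, ∃ γ : ℝ, 1 ≤ n → AxisRateOne n γ := fun n ↦ by
    by_cases hn : 1 ≤ n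
    · obtain ⟨γ, hγ⟩ := (hE n hn).1
      exact ⟨γ, fun _ ↦ hγ⟩
    · exact ⟨0, fun h ↦ absurd h hn⟩
  have hE₂ : ∀ n : ℕ, ∃ γ : ℝ, 1 ≤ n → AxisRateTwo n γ := fun n ↦ by
    by_cases hn : 1 ≤ n
    · obtain ⟨γ, hγ⟩ := (hE n hn).2
      exact ⟨γ, fun _ ↦ hγ⟩
    · exact ⟨0, fun h ↦ absurd h hn⟩
  choose γ₁ hγ₁ using hE₁
  choose γ₂ hγ₂ using hE₂
  -- diagonal Kac rates from the lattice representation + the scaling analysis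
  obtain ⟨ρ₁, ρ₂, hρ₁, hρ₂, ⟨C, a₁, a₂, x₁, hev⟩, ⟨C', b₁, b₂, z₁, z₂, hev'⟩⟩ := hL
  have h₁ : Tendsto (fun j : ℕ ↦ ((2 * j : ℕ) : ℝ) * ρ₁ j) atTop (𝓝 (2 * π / 3)) := by
    have key := hS₂ (π / 3) hD₂ (fun j ↦ 2 * j) a₁ a₂ x₁ C tendsto_two_mul_atTop
      (hev.mono fun j hj ↦ ⟨hj.1, hj.2.1⟩)
    rw [show (2 * π / 3 : ℝ) = 2 * (π / 3) by ring]
    refine key.congr' ?_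
    filter_upwards [hev] with j hj
    rw [hj.2.2]
  have h₂ : Tendsto (fun j : ℕ ↦ ((2 * j : ℕ) : ℝ) * ρ₂ j) atTop (𝓝 (4 * π)) := by
    have key := hS₄ (2 * π) hD₄ (fun j ↦ 2 * j) b₁ b₂ z₁ z₂ C' tendsto_two_mul_atTop
      (hev'.mono fun j hj ↦ ⟨hj.1, hj.2.1, hj.2.2.1⟩)
    rw [show (4 * π : ℝ) = 2 * (2 * π) by ring]
    refine key.congr' ?_
    filter_upwards [hev'] with j hj
    rw [hj.2.2.2]
  have hK : DiagonalKacRates := ⟨ρ₁, ρ₂, hρ₁, hρ₂, h₁, h₂⟩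
  obtain ⟨h₃, h₄⟩ := hB hK γ₁ γ₂ hγ₁ hγ₂
  exact ⟨γ₁, γ₂, hγ₁, hγ₂, h₃, h₄⟩

/-- The crux from the registered stubs (the lead's closing theorem: sorry-free once every `stub_*` is replaced by
its landed helper and `StripRatesExist` (stmt-CriticalPhenomena-13879, support, provable now) by its `_holds`
theorem; its type is literally `StripRatesExist → <route decl>`). -/
theorem stripClusterRates_proof (hE : StripRatesExist) : StripClusterRates :=
  StripClusterRates_of stub_orientationBridge stub_latticeTBA stub_dilogTwo stub_dilogFour
    stub_scalingLimitTwo stub_scalingLimitFour hE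

end Summit.CriticalPhenomena.CardyFormulaZ2.Cruxes.StripClusterRates.ScalingTbaPositiveLogs

end
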